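import Literature.Analysis.FluidPDE.CylindricalIntegration
import Mathlib.MeasureTheory.Integral.Prod
import HarnessLib

/-!
# Space–time integrability of integrands with the axis weight `1/r`

Analysis/FluidPDE proofs file (theorems only). The energy identity for the swirl equation
(`LeiZhang2011.energy_identity`, Lei–Zhang, J. Funct. Anal. 261 (2011) = arXiv:1011.5066, §2
(2.2)–(2.3)) carries the hypothesis that the space–time integrand
`(H'(Γ) N η + H(Γ) η') φ²`, `N = ΔΓ − b·∇Γ − (2/r)∂ᵣΓ`, is integrable on `(t₁, t₂] × ℝ³`. In the
smooth bounded setting of the paper all factors are bounded except the axis weight `2/r`, which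
is locally integrable in `ℝ³` (`dx = r dr dθ dz`; the tree's
`integrableOn_inv_cylRadius_solidCylinder`). This file isolates the resulting integrability
criterion: a jointly measurable function on `(t₁, t₂] × ℝ³` supported in `(t₁, t₂] × K`, `K`
compact, and bounded by `C (1 + 1/r)` there, is integrable for the product measure
(`integrable_prod_of_le_mul_one_add_inv_cylRadius`).

## References

* Z. Lei, Q. S. Zhang, J. Funct. Anal. 261 (2011) = arXiv:1011.5066, §2 (2.2)–(2.3).
  [LeiZhang2011]
-/

noncomputable section

open MeasureTheory Set Function Filter Metric

namespace Literature.Analysis.FluidPDE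

/-- `x ↦ 1 + 1/r(x)` is integrable on every compact subset of `ℝ³` (`1/r ∈ L¹_loc(ℝ³)`, the
tree's `integrableOn_inv_cylRadius_solidCylinder`, and a compact set lies in a cylinder box).
[folklore] -/
theorem integrableOn_one_add_inv_cylRadius {K : Set (EuclideanSpace ℝ (Fin 3))}
    (hK : IsCompact K) :
    IntegrableOn (fun x => 1 + (cylRadius x)⁻¹) K volume := by
  obtain ⟨R, hR⟩ := hK.isBounded.subset_closedBall (0 : EuclideanSpace ℝ (Fin 3))
  have hKc : K ⊆ solidCylinder R R := hR.trans (closedBall_subset_solidCylinder R)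
  have h1 : IntegrableOn (fun _ : EuclideanSpace ℝ (Fin 3) => (1 : ℝ)) K volume :=
    integrableOn_const hK.measure_lt_top.ne
  exact h1.add ((integrableOn_inv_cylRadius_solidCylinder R R).mono_set hKc)

/-- **Space–time integrability against the axis weight.** Let `K ⊆ ℝ³` be compact and
`f : ℝ × ℝ³ → ℝ` a.e.-strongly measurable for `(vol|(t₁,t₂]) × vol`, vanishing for `x ∉ K` and
with `|f(s, x)| ≤ C (1 + 1/r(x))` for `s ∈ (t₁, t₂]`, `x ∈ K`. Then `f` is integrable on
`(t₁, t₂] × ℝ³` (domination by `C · 1_{(t₁,t₂]}(s) (1 + 1/r) 1_K(x)`, a product of integrable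
functions). This discharges the integrability hypothesis of `LeiZhang2011.energy_identity` in
the bounded smooth setting. [folklore] -/
theorem integrable_prod_of_le_mul_one_add_inv_cylRadius {f : ℝ × EuclideanSpace ℝ (Fin 3) → ℝ}
    {t₁ t₂ : ℝ} {K : Set (EuclideanSpace ℝ (Fin 3))} (hK : IsCompact K)
    (hfm : AEStronglyMeasurable f ((volume.restrict (Ioc t₁ t₂)).prod volume))
    (hfK : ∀ s x, x ∉ K → f (s, x) = 0) {C : ℝ}
    (hfC : ∀ s ∈ Ioc t₁ t₂, ∀ x ∈ K, |f (s, x)| ≤ C * (1 + (cylRadius x)⁻¹)) :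
    Integrable f ((volume.restrict (Ioc t₁ t₂)).prod volume) := by
  -- the dominating product function
  set g : ℝ × EuclideanSpace ℝ (Fin 3) → ℝ := fun p =>
    (1 : ℝ) * K.indicator (fun x => |C| * (1 + (cylRadius x)⁻¹)) p.2 with hg
  have hgi : Integrable g ((volume.restrict (Ioc t₁ t₂)).prod volume) := by
    have h1 : Integrable (fun _ : ℝ => (1 : ℝ)) (volume.restrict (Ioc t₁ t₂)) :=
      integrableOn_const measure_Ioc_lt_top.ne
    have h2 : Integrable (K.indicator fun x => |C| * (1 + (cylRadius x)⁻¹))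
        (volume : Measure (EuclideanSpace ℝ (Fin 3))) :=
      IntegrableOn.integrable_indicator ((integrableOn_one_add_inv_cylRadius hK).const_mul |C|)
        hK.measurableSet
    exact h1.mul_prod h2
  refine hgi.mono' hfm ?_
  -- the pointwise bound holds for all `s ∈ (t₁, t₂]` and all `x`
  have hprod : (volume.restrict (Ioc t₁ t₂)).prod (volume : Measure (EuclideanSpace ℝ (Fin 3))) =
      ((volume : Measure ℝ).prod (volume : Measure (EuclideanSpace ℝ (Fin 3)))).restrict
        (Ioc t₁ t₂ ×ˢ univ) := by
    rw [← Measure.prod_restrict, Measure.restrict_univ]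
  have hs : ∀ᵐ p ∂((volume.restrict (Ioc t₁ t₂)).prod (volume : Measure (EuclideanSpace ℝ (Fin 3)))),
      p ∈ Ioc t₁ t₂ ×ˢ (univ : Set (EuclideanSpace ℝ (Fin 3))) := by
    rw [hprod]
    exact ae_restrict_mem (measurableSet_Ioc.prod MeasurableSet.univ)
  filter_upwards [hs] with p hp
  obtain ⟨s, x⟩ := p
  have hs' : s ∈ Ioc t₁ t₂ := hp.1
  rw [Real.norm_eq_abs]
  by_cases hx : x ∈ K
  · simp only [hg, indicator_of_mem hx, one_mul]
    calc |f (s, x)| ≤ C * (1 + (cylRadius x)⁻¹) := hfC s hs' x hx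
      _ ≤ |C| * (1 + (cylRadius x)⁻¹) :=
          mul_le_mul_of_nonneg_right (le_abs_self C)
            (add_nonneg zero_le_one (inv_nonneg.2 (cylRadius_nonneg x)))
  · simp only [hg, indicator_of_notMem hx, mul_zero, hfK s x hx, abs_zero, le_refl]

end Literature.Analysis.FluidPDE
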